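import Literature.Probability.Percolation.AdjExitOfRoute
import Literature.Probability.Percolation.AdjExitOfRouteCross
import HarnessLib

/-!
# The tight exterior footprint of the clean routes of the exits

Topic `Literature/Probability/Percolation`; family `crit-perc` / near-critical percolation on `𝕋`.
A brick of the near-critical arm-separation theorem for four arms in the ADJACENT colour
arrangement (P. Nolin, EJP 13 (2008), Thm. 11, `j = 4`, `σ = BBWW` [arXiv 0711.4948: Thm. 10];
the input `hsepAdj` of `Werner2009_lemma63_of_altSeparation_of_adjSeparation`), supports of the
exit events for Nolin's Lemma 13 (generalised FKG).

The route of an exit (`PairData.exitOfRoute`, `CrossData.exitBelow₁/exitUp₁`) lies in `Λ_{2M}` except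
for sites of its own fence connection, which sit in the square about the tip of the fence; outside
`Λ_{2M}` the connection of a fence FROM BELOW lies strictly ABOVE the tip row `z₁` (rows
`(z₁, z₁ + 2k + 1]`), that of a fence FROM ABOVE strictly BELOW its tip `z⁺` (rows
`[z⁺₁ - 2k - 1, z⁺₁)`, i.e. `[ζ + k - 1, ζ + 3k)` for the nominal row `ζ = z⁺₁ - 3k`). In terms of the
nominal tip `z` and the scale `k ≥ 2` of the exit, in both cases:

  `ExitTight z k v`:  `z₁ < v₁ < z₁ + 3k` and `z₀ - (2k+1) ≤ v₀ ≤ z₀ + (2k+1)`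

for every site `v` of the route outside `Λ_{2M}` (`exitOfRoute_tight`, `exitBelow₁_tight`,
`exitUp₁_tight`). This is what makes the support of the event "two exits of one colour" disjoint
from the corridors of the other colour even when a tip from below of one colour sits just above a
tip from above of the other colour (`AdjExitGaps.lean`).

Everything here is proved; no named facts are introduced.

## References

* P. Nolin, Near-critical percolation in two dimensions, *Electron. J. Probab.* 13 (2008), §4.2
  Def. 6–8, §4.3 Lemma 13, §4.4 (arXiv 0711.4948: Def. 6–8, Lemma 12, Lemma 14) [Nolin2008].
-/

noncomputable section

open Set

namespace Literature.Probability.Percolation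

open LatticeModels
open PairData (term_isCrossing term_eq tip_mem term_open term_norm_le)

/-- **The tight exterior footprint** of an exit with nominal tip `z` and scale `k`: rows strictly
between `z₁` and `z₁ + 3k`, columns of the square of half-width `2k + 1` about `z`. [folklore] -/
def ExitTight (z : Site 2) (k : ℕ) (v : Site 2) : Prop :=
  z 1 < v 1 ∧ v 1 < z 1 + 3 * k ∧ z 0 - (2 * k + 1) ≤ v 0 ∧ v 0 ≤ z 0 + (2 * k + 1)

/-- The exterior sites of a fence set from below are tight about its tip (`2 ≤ k`). [folklore] -/
theorem exitTight_of_mem_fenceSet {M k : ℕ} {c : Finset (Site 2)} {z v : Site 2} {ω : SiteConfig (Site 2)} {S : Set (Site 2)}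
    (hk : 2 ≤ k) (hv : v ∈ fenceSet M c z k ω S) (hn : 2 * (M : ℤ) < triNorm v) : ExitTight z k v := by
  have h1 := mem_fenceSet_outside hv hn
  have hb := fenceSet_box hv
  refine ⟨h1, ?_, hb.1, hb.2.1⟩
  have : (2 : ℤ) ≤ k := by exact_mod_cast hk
  linarith [hb.2.2.2]

/-- The exterior sites of a fence set from above with tip `z⁺` are tight about the nominal tip
`zUp z⁺ k` (`2 ≤ k`). [folklore] -/
theorem exitTight_of_mem_fenceSetUp {M k : ℕ} {d : Finset (Site 2)} {z v : Site 2} {ω : SiteConfig (Site 2)} {S : Set (Site 2)}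
    (hk : 2 ≤ k) (hv : v ∈ fenceSetUp M d z k ω S) (hn : 2 * (M : ℤ) < triNorm v) : ExitTight (zUp z k) k v := by
  have h1 := mem_fenceSetUp_outside hv hn
  have hb := fenceSetUp_box hv
  have : (2 : ℤ) ≤ k := by exact_mod_cast hk
  refine ⟨?_, ?_, ?_, ?_⟩
  · rw [zUp_one]; linarith [hb.2.2.1]
  · rw [zUp_one]; linarith
  · rw [zUp_zero]; exact hb.1
  · rw [zUp_zero]; exact hb.2.1

/-! ### Same-frame exits -/

namespace PairData

variable {M n k₀ K T : ℕ} {χ : SiteConfig (Site 2)}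

/-- **The route of `exitOfRoute` is tight outside `Λ_{2M}`.** [folklore] -/
theorem exitOfRoute_tight (D : PairData M n k₀ K T χ) (i : Fin 2) {u : ℕ} {c : Finset (Site 2)} {z : Site 2}
    (hu : (trapDomain M).lowestSeq χ u = some (c, z)) {S : Set (Site 2)} (hP : PathIn triGraph S (D.a i) (D.fence hu).m)
    (hS : S ⊆ D.Bset ∪ (D.fence hu).F) :
    ∀ v ∈ S, 2 * (M : ℤ) < triNorm v → ExitTight (D.exitOfRoute i hu hP hS).z (D.exitOfRoute i hu hP hS).k v := by
  intro v hv hn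
  have hvF := D.clean_route_exterior hu hS hv hn
  rw [exitOfRoute_z, exitOfRoute_k]
  exact exitTight_of_mem_fenceSet (D.two_le_kOf hu) ((D.fence hu).F_subset hvF) hn

end PairData

/-! ### Cross-frame exits -/

namespace CrossData

variable {M n k₀ K T₁ T₁' T₂ T₂' i₁ i₂ : ℕ} {ω : SiteConfig (Site 2)}
  (X : CrossData M n k₀ K T₁ T₁' T₂ T₂' (rotConfig i₁ ω) (rotConfig i₂ ω))

/-- Non-fence admissible sites lie in `Λ_{2M}` (rotations preserve the norm). [folklore] -/
theorem B𝔅_norm_le (hφ₁ : ∀ u, X.φ₁ u = triRotIsoPow i₁ u) (hφ₂ : ∀ u, X.φ₂ u = triRotIsoPow i₂ u)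
    {w : Site 2} (hw : w ∈ X.B𝔅) : triNorm w ≤ 2 * M := by
  rcases X.mem_B𝔅 hw with ⟨x, hx, hxw⟩ | ⟨x, hx, hxw⟩
  · rw [← hxw, hφ₁, triNorm_triRotIsoPow]
    rcases hx with hx | ⟨u, c, z, hu, hx⟩ | ⟨u, d, z, hu, hx⟩
    · exact X.D₁.armSet_norm_le hx
    · exact term_norm_le hu hx
    · exact (mem_trapD_iff_triNorm.1 ((PairDataB.termUp_isCrossing hu).subset hx)).2
  · rw [← hxw, hφ₂, triNorm_triRotIsoPow]
    rcases hx with hx | ⟨u, c, z, hu, hx⟩ | ⟨u, d, z, hu, hx⟩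
    · exact X.D₂.armSet_norm_le hx
    · exact term_norm_le hu hx
    · exact (mem_trapD_iff_triNorm.1 ((PairDataB.termUp_isCrossing hu).subset hx)).2

/-- A site of a clean route read in the frame of `D₁` and outside `Λ_{2M}` is a site of the fence. [folklore] -/
theorem symm_mem_fence_of_norm (hφ₁ : ∀ u, X.φ₁ u = triRotIsoPow i₁ u) (hφ₂ : ∀ u, X.φ₂ u = triRotIsoPow i₂ u)
    {F S : Set (Site 2)} (hS : S ⊆ X.B𝔅 ∪ X.φ₁ '' F) {v : Site 2} (hv : v ∈ X.φ₁.symm '' S) (hn : 2 * (M : ℤ) < triNorm v) :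
    v ∈ F := by
  obtain ⟨w, hw, rfl⟩ := hv
  rcases hS hw with hw' | ⟨y, hy, hyw⟩
  · exfalso
    have h := X.B𝔅_norm_le hφ₁ hφ₂ hw'
    rw [X.symm_eq₁ hφ₁, ← triNorm_triRotIsoPow i₁ ((triRotIsoPow i₁).symm w), RelIso.apply_symm_apply] at hn
    exact absurd h (not_le.2 hn)
  · rw [← hyw, RelIso.symm_apply_apply]; exact hy

/-- **The route of `exitBelow₁` is tight outside `Λ_{2M}`.** [folklore] -/
theorem exitBelow₁_tight (hi₁ : i₁ < 6) (hφ₁ : ∀ u, X.φ₁ u = triRotIsoPow i₁ u) (hφ₂ : ∀ u, X.φ₂ u = triRotIsoPow i₂ u)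
    {u : ℕ} {c : Finset (Site 2)} {z : Site 2} (hu : (trapDomain M).lowestSeq (rotConfig i₁ ω) u = some (c, z)) (i : Fin 2)
    {S : Set (Site 2)} (hP : PathIn triGraph S (X.φ₁ (X.D₁.a i)) (X.φ₁ (X.D₁.fence hu).m))
    (hS : S ⊆ X.B𝔅 ∪ X.φ₁ '' (X.D₁.fence hu).F) :
    ∀ v ∈ X.φ₁.symm '' S, 2 * (M : ℤ) < triNorm v →
      ExitTight (X.exitBelow₁ hi₁ hφ₁ hφ₂ hu i hP hS).z (X.exitBelow₁ hi₁ hφ₁ hφ₂ hu i hP hS).k v := by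
  intro v hv hn
  have hvF := X.symm_mem_fence_of_norm hφ₁ hφ₂ hS hv hn
  rw [exitBelow₁_z, exitBelow₁_k]
  exact exitTight_of_mem_fenceSet (X.D₁.two_le_kOf hu) ((X.D₁.fence hu).F_subset hvF) hn

/-- **The route of `exitUp₁` is tight outside `Λ_{2M}`** (about the nominal tip). [folklore] -/
theorem exitUp₁_tight (hi₁ : i₁ < 6) (hφ₁ : ∀ u, X.φ₁ u = triRotIsoPow i₁ u) (hφ₂ : ∀ u, X.φ₂ u = triRotIsoPow i₂ u)
    {u : ℕ} {d : Finset (Site 2)} {z : Site 2} (hu : (trapDomain M).flip.lowestSeq (rotConfig i₁ ω) u = some (d, z)) (i : Fin 2)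
    {S : Set (Site 2)} (hP : PathIn triGraph S (X.φ₁ (X.D₁.a i)) (X.φ₁ (X.D₁.fenceUp hu).m))
    (hS : S ⊆ X.B𝔅 ∪ X.φ₁ '' (X.D₁.fenceUp hu).F) :
    ∀ v ∈ X.φ₁.symm '' S, 2 * (M : ℤ) < triNorm v →
      ExitTight (X.exitUp₁ hi₁ hφ₁ hφ₂ hu i hP hS).z (X.exitUp₁ hi₁ hφ₁ hφ₂ hu i hP hS).k v := by
  intro v hv hn
  have hvF := X.symm_mem_fence_of_norm hφ₁ hφ₂ hS hv hn
  rw [exitUp₁_z, exitUp₁_k]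
  exact exitTight_of_mem_fenceSetUp (X.D₁.two_le_kOfUp hu) ((X.D₁.fenceUp hu).F_subset hvF) hn

end CrossData

end Literature.Probability.Percolation
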